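import Literature.NumberTheory.Weil1964.AdelicThetaTensorMajorants
import Literature.NumberTheory.Automorphic.AdelicSchwartzBruhatTensor
import Literature.NumberTheory.Automorphic.SmoothRepresentationLocallyConstant
import HarnessLib

/-!
# Theta majorants of a tensor product representation `π_∞ ⊗ π_f` on `𝒮(𝔸_Fⁿ)`

**Junction theorem** for the theta kernel of a representation given place by place.  The tree's
`adelicTensorRep π_∞ π_f` / `adelicRep ω_∞ ω_f` (`AdelicSchwartzBruhatTensor`) make a representation `π_∞` of
`G` on the Schwartz space `𝓢((F ⊗ ℝ)ⁿ)` and a representation `π_f` of `G` on the finite-adelic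
Schwartz–Bruhat space `𝒮((𝔸_{F,f})ⁿ)` act on `𝒮(𝔸_Fⁿ) = piSchwartzBruhat F (Fin n)` by
`Φ_∞ ⊗ Φ_f ↦ π_∞(g)Φ_∞ ⊗ π_f(g)Φ_f`.  We prove: if

* `g ↦ π_∞(g)Φ_∞` is continuous into the Fréchet space `𝓢` for every `Φ_∞` (or, more generally, is an
  archimedean factor in the sense of `IsArchFactor`: pointwise continuous with locally uniform decay), and
* `g ↦ π_f(g)Φ_f` is locally constant for every `Φ_f` (a smooth representation of a totally disconnected
  group, cf. `Representation.IsSmooth`),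

then `adelicTensorRep π_∞ π_f` is a tensor action (`IsTensorAction`, `AdelicThetaTensorMajorants`), hence has
theta majorants (`HasThetaMajorants`, `AdelicThetaMajorants`), hence the theta kernel
`g ↦ Θ(π(g)Φ) = Σ_{ξ ∈ Fⁿ} (π(g)Φ)(ξ)` is continuous for every `Φ ∈ 𝒮(𝔸_Fⁿ)` — Weil (1964), n° 41,
Lemme 5 p. 194 / Théorème 6 p. 193, conclusion 1, for representations given place by place; this is the
hypothesis `hω` of the theta-kernel datum `ThetaKernelDatum.adelicOfDualPairRep` (`ThetaDualPairDatum`).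
Everything here is proved. [folklore]
-/

set_option autoImplicit false

noncomputable section

open scoped BigOperators Topology Classical SchwartzMap
open NumberField NumberField.mixedEmbedding IsDedekindDomain Set Filter

namespace Literature.NumberTheory.Weil1964

open Literature.NumberTheory.Automorphic

variable {F : Type} [Field F] [NumberField F] {n : ℕ} {G : Type*} [Monoid G]

/-! ### The finite factor of a representation on `𝒮((𝔸_{F,f})ⁿ)` -/

/-- The finite factor attached to a representation on `𝒮((𝔸_{F,f})ⁿ)`: `Ψ ↦ π_f(g)Ψ` on Schwartz–Bruhat
functions (extended by the identity off the Schwartz–Bruhat space, where it is never used). [folklore] -/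
def finFactorOfRep (πfin : Representation ℂ G (FinSB F (Fin n))) (g : G)
    (Ψ : (Fin n → FiniteAdeleRing (𝓞 F) F) → ℂ) : (Fin n → FiniteAdeleRing (𝓞 F) F) → ℂ :=
  if h : Ψ ∈ SchwartzBruhat (Fin n → FiniteAdeleRing (𝓞 F) F) then
    ((πfin g ⟨Ψ, h⟩ : FinSB F (Fin n)) : (Fin n → FiniteAdeleRing (𝓞 F) F) → ℂ)
  else Ψ

/-- On Schwartz–Bruhat functions the finite factor is `π_f(g)`. [folklore] -/
theorem finFactorOfRep_apply_of_mem (πfin : Representation ℂ G (FinSB F (Fin n))) (g : G)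
    {Ψ : (Fin n → FiniteAdeleRing (𝓞 F) F) → ℂ} (h : Ψ ∈ SchwartzBruhat (Fin n → FiniteAdeleRing (𝓞 F) F)) :
    finFactorOfRep πfin g Ψ = ((πfin g ⟨Ψ, h⟩ : FinSB F (Fin n)) : (Fin n → FiniteAdeleRing (𝓞 F) F) → ℂ) :=
  dif_pos h

variable [TopologicalSpace G]

/-- A representation on `𝒮((𝔸_{F,f})ⁿ)` with locally constant orbit maps `g ↦ π_f(g)Ψ` is a finite
factor (`IsFinFactor`). [folklore] -/
theorem isFinFactor_finFactorOfRep (πfin : Representation ℂ G (FinSB F (Fin n)))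
    (hf : ∀ Ψ : FinSB F (Fin n), IsLocallyConstant fun g => πfin g Ψ) :
    IsFinFactor (finFactorOfRep πfin) := by
  refine ⟨fun g Ψ h => ?_, fun Ψ h => ?_⟩
  · rw [finFactorOfRep_apply_of_mem πfin g h]; exact (πfin g ⟨Ψ, h⟩).2
  · have : (fun g => finFactorOfRep πfin g Ψ) = Subtype.val ∘ fun g => πfin g ⟨Ψ, h⟩ :=
      funext fun g => finFactorOfRep_apply_of_mem πfin g h
    rw [this]
    exact (hf ⟨Ψ, h⟩).comp _

/-! ### `π_∞ ⊗ π_f` is a tensor action; theta majorants; continuity of the theta kernel -/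

/-- `π_∞ ⊗ π_f` is a **tensor action** with archimedean factor `π_∞` and finite factor `π_f`. [folklore] -/
theorem isTensorAction_adelicTensorRep (πinf : Representation ℂ G 𝓢((Fin n → mixedSpace F), ℂ))
    (πfin : Representation ℂ G (FinSB F (Fin n))) (hA : IsArchFactor fun g Φ => πinf g Φ)
    (hf : ∀ Ψ : FinSB F (Fin n), IsLocallyConstant fun g => πfin g Ψ) :
    IsTensorAction (fun g => (adelicTensorRep πinf πfin g : Module.End ℂ ↥(piSchwartzBruhat F (Fin n))))
      (fun g Φ => πinf g Φ) (finFactorOfRep πfin) := by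
  refine ⟨hA, isFinFactor_finFactorOfRep πfin hf, fun g Φinf Φfin hfin => ?_⟩
  rw [coe_adelicTensorRep_apply_tensor πinf πfin g Φinf hfin, finFactorOfRep_apply_of_mem πfin g hfin]

/-- **Junction theorem.** If `g ↦ π_∞(g)Φ_∞` is continuous into `𝓢` and `g ↦ π_f(g)Φ_f` is locally
constant, then `π_∞ ⊗ π_f` has theta majorants. [folklore] -/
theorem hasThetaMajorants_adelicTensorRep (πinf : Representation ℂ G 𝓢((Fin n → mixedSpace F), ℂ))
    (πfin : Representation ℂ G (FinSB F (Fin n))) (hinf : ∀ Φ, Continuous fun g => πinf g Φ)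
    (hf : ∀ Ψ : FinSB F (Fin n), IsLocallyConstant fun g => πfin g Ψ) :
    HasThetaMajorants (F := F) fun g Φ => adelicTensorRep πinf πfin g Φ :=
  (isTensorAction_adelicTensorRep πinf πfin (IsArchFactor.of_continuous hinf) hf).hasThetaMajorants

/-- The same with the archimedean factor given as an `IsArchFactor` (pointwise continuity and locally
uniform decay only). [folklore] -/
theorem hasThetaMajorants_adelicTensorRep_of_isArchFactor
    (πinf : Representation ℂ G 𝓢((Fin n → mixedSpace F), ℂ)) (πfin : Representation ℂ G (FinSB F (Fin n)))
    (hA : IsArchFactor fun g Φ => πinf g Φ) (hf : ∀ Ψ : FinSB F (Fin n), IsLocallyConstant fun g => πfin g Ψ) :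
    HasThetaMajorants (F := F) fun g Φ => adelicTensorRep πinf πfin g Φ :=
  (isTensorAction_adelicTensorRep πinf πfin hA hf).hasThetaMajorants

/-- **Continuity of the theta kernel** `g ↦ Θ((π_∞ ⊗ π_f)(g)Φ) = Σ_{ξ ∈ Fⁿ} ((π_∞ ⊗ π_f)(g)Φ)(ξ)`
(Weil (1964), n° 41, Théorème 6, conclusion 1, for representations given place by place). [folklore] -/
theorem continuous_thetaDistLM_adelicTensorRep (πinf : Representation ℂ G 𝓢((Fin n → mixedSpace F), ℂ))
    (πfin : Representation ℂ G (FinSB F (Fin n))) (hinf : ∀ Φ, Continuous fun g => πinf g Φ)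
    (hf : ∀ Ψ : FinSB F (Fin n), IsLocallyConstant fun g => πfin g Ψ)
    (Φ : ↥(piSchwartzBruhat F (Fin n))) :
    Continuous fun g => thetaDistLM F (Fin n) (adelicTensorRep πinf πfin g Φ) :=
  (hasThetaMajorants_adelicTensorRep πinf πfin hinf hf).continuous_thetaDistLM Φ

/-- Pointwise continuity `g ↦ ((π_∞ ⊗ π_f)(g)Φ)(x)` for every `Φ ∈ 𝒮(𝔸_Fⁿ)` (not only pure tensors).
[folklore] -/
theorem continuous_adelicTensorRep_apply (πinf : Representation ℂ G 𝓢((Fin n → mixedSpace F), ℂ))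
    (πfin : Representation ℂ G (FinSB F (Fin n))) (hinf : ∀ Φ, Continuous fun g => πinf g Φ)
    (hf : ∀ Ψ : FinSB F (Fin n), IsLocallyConstant fun g => πfin g Ψ)
    (Φ : ↥(piSchwartzBruhat F (Fin n))) (x : Fin n → AdeleRing (𝓞 F) F) :
    Continuous fun g => ((adelicTensorRep πinf πfin g Φ : ↥(piSchwartzBruhat F (Fin n))) :
      (Fin n → AdeleRing (𝓞 F) F) → ℂ) x :=
  (isTensorAction_adelicTensorRep πinf πfin (IsArchFactor.of_continuous hinf) hf).continuous_apply Φ x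

/-! ### The adelic representation `ω_∞ ⊗ ω_f` of `G_∞ × G_f` -/

section Adelic

variable {Ginf : Type*} {Gfin : Type*} [Monoid Ginf] [Monoid Gfin] [TopologicalSpace Ginf]
  [TopologicalSpace Gfin]

/-- **Theta majorants of the adelic representation** `ω = ω_∞ ⊗ ω_f` of `G_∞ × G_f`
(`adelicRep`): `ω_∞` strongly continuous on `𝓢`, `ω_f` with locally constant orbit maps. [folklore] -/
theorem hasThetaMajorants_adelicRep (ωinf : Representation ℂ Ginf 𝓢((Fin n → mixedSpace F), ℂ))
    (ωfin : Representation ℂ Gfin (FinSB F (Fin n))) (hinf : ∀ Φ, Continuous fun g => ωinf g Φ)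
    (hf : ∀ Ψ : FinSB F (Fin n), IsLocallyConstant fun g => ωfin g Ψ) :
    HasThetaMajorants (F := F) fun g Φ => adelicRep ωinf ωfin g Φ :=
  hasThetaMajorants_adelicTensorRep _ _ (fun Φ => (hinf Φ).comp continuous_fst)
    fun Ψ => (hf Ψ).comp_continuous continuous_snd

/-- The same with `ω_∞` given as an `IsArchFactor`. [folklore] -/
theorem hasThetaMajorants_adelicRep_of_isArchFactor
    (ωinf : Representation ℂ Ginf 𝓢((Fin n → mixedSpace F), ℂ)) (ωfin : Representation ℂ Gfin (FinSB F (Fin n)))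
    (hA : IsArchFactor fun g Φ => ωinf g Φ) (hf : ∀ Ψ : FinSB F (Fin n), IsLocallyConstant fun g => ωfin g Ψ) :
    HasThetaMajorants (F := F) fun g Φ => adelicRep ωinf ωfin g Φ :=
  hasThetaMajorants_adelicTensorRep_of_isArchFactor _ _
    ⟨fun Φ x => (hA.continuous_eval Φ x).comp continuous_fst, fun Φ k g₀ => by
      obtain ⟨V, hV, S, hS0, hS⟩ := hA.decay Φ k g₀.1
      exact ⟨Prod.fst ⁻¹' V, continuous_fst.continuousAt.preimage_mem_nhds hV, S, hS0,
        fun g hg x => hS g.1 hg x⟩⟩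
    fun Ψ => (hf Ψ).comp_continuous continuous_snd

/-- **Continuity of the theta kernel of `ω_∞ ⊗ ω_f`**: `(g_∞, g_f) ↦ Θ(ω(g_∞, g_f)Φ)` is continuous
for every `Φ ∈ 𝒮(𝔸_Fⁿ)` (Weil (1964), n° 41, Théorème 6, conclusion 1). [folklore] -/
theorem continuous_thetaDistLM_adelicRep (ωinf : Representation ℂ Ginf 𝓢((Fin n → mixedSpace F), ℂ))
    (ωfin : Representation ℂ Gfin (FinSB F (Fin n))) (hinf : ∀ Φ, Continuous fun g => ωinf g Φ)
    (hf : ∀ Ψ : FinSB F (Fin n), IsLocallyConstant fun g => ωfin g Ψ)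
    (Φ : ↥(piSchwartzBruhat F (Fin n))) :
    Continuous fun g => thetaDistLM F (Fin n) (adelicRep ωinf ωfin g Φ) :=
  (hasThetaMajorants_adelicRep ωinf ωfin hinf hf).continuous_thetaDistLM Φ

/-- Pulling back along a continuous homomorphism `s : H →* G_∞ × G_f` (e.g. the diagonal map of the
adelic points of a dual pair `U(V)(𝔸) × U(W)(𝔸) → (·)_∞ × (·)_f`). [folklore] -/
theorem hasThetaMajorants_adelicRep_comp {H : Type*} [Monoid H] [TopologicalSpace H]
    (ωinf : Representation ℂ Ginf 𝓢((Fin n → mixedSpace F), ℂ)) (ωfin : Representation ℂ Gfin (FinSB F (Fin n)))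
    (hinf : ∀ Φ, Continuous fun g => ωinf g Φ) (hf : ∀ Ψ : FinSB F (Fin n), IsLocallyConstant fun g => ωfin g Ψ)
    (s : H →* Ginf × Gfin) (hs : Continuous s) :
    HasThetaMajorants (F := F) fun h Φ => (adelicRep ωinf ωfin).comp s h Φ :=
  (hasThetaMajorants_adelicRep ωinf ωfin hinf hf).comp hs

end Adelic

/-! ### Smooth finite factor (`Representation.IsSmooth`) -/

section Smooth

variable {G' : Type*} [Group G'] [TopologicalSpace G'] [SeparatelyContinuousMul G']
  {Ginf : Type*} {Gfin : Type*} [Monoid Ginf] [TopologicalSpace Ginf] [Group Gfin] [TopologicalSpace Gfin]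
  [SeparatelyContinuousMul Gfin]

/-- `π_∞ ⊗ π_f` has theta majorants when `π_∞` is strongly continuous on `𝓢` and `π_f` is a **smooth**
representation (`Representation.IsSmooth`: open stabilisers; locally constant orbit maps by
`Representation.IsSmooth.isLocallyConstant_apply`). [folklore] -/
theorem hasThetaMajorants_adelicTensorRep_of_isSmooth (πinf : Representation ℂ G' 𝓢((Fin n → mixedSpace F), ℂ))
    (πfin : Representation ℂ G' (FinSB F (Fin n))) (hinf : ∀ Φ, Continuous fun g => πinf g Φ)
    (hfin : πfin.IsSmooth) : HasThetaMajorants (F := F) fun g Φ => adelicTensorRep πinf πfin g Φ :=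
  hasThetaMajorants_adelicTensorRep πinf πfin hinf
    fun Ψ => Representation.IsSmooth.isLocallyConstant_apply πfin hfin Ψ

/-- **Theta majorants of `ω_∞ ⊗ ω_f`** for `ω_∞` strongly continuous on `𝓢` and `ω_f` smooth. [folklore] -/
theorem hasThetaMajorants_adelicRep_of_isSmooth (ωinf : Representation ℂ Ginf 𝓢((Fin n → mixedSpace F), ℂ))
    (ωfin : Representation ℂ Gfin (FinSB F (Fin n))) (hinf : ∀ Φ, Continuous fun g => ωinf g Φ)
    (hfin : ωfin.IsSmooth) : HasThetaMajorants (F := F) fun g Φ => adelicRep ωinf ωfin g Φ :=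
  hasThetaMajorants_adelicRep ωinf ωfin hinf
    fun Ψ => Representation.IsSmooth.isLocallyConstant_apply ωfin hfin Ψ

/-- … and with `ω_∞` an `IsArchFactor`. [folklore] -/
theorem hasThetaMajorants_adelicRep_of_isArchFactor_of_isSmooth
    (ωinf : Representation ℂ Ginf 𝓢((Fin n → mixedSpace F), ℂ)) (ωfin : Representation ℂ Gfin (FinSB F (Fin n)))
    (hA : IsArchFactor fun g Φ => ωinf g Φ) (hfin : ωfin.IsSmooth) :
    HasThetaMajorants (F := F) fun g Φ => adelicRep ωinf ωfin g Φ :=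
  hasThetaMajorants_adelicRep_of_isArchFactor ωinf ωfin hA
    fun Ψ => Representation.IsSmooth.isLocallyConstant_apply ωfin hfin Ψ

/-- **Continuity of the theta kernel of `ω_∞ ⊗ ω_f`** (`ω_∞` strongly continuous, `ω_f` smooth):
Weil (1964), n° 41, Théorème 6, conclusion 1. [folklore] -/
theorem continuous_thetaDistLM_adelicRep_of_isSmooth
    (ωinf : Representation ℂ Ginf 𝓢((Fin n → mixedSpace F), ℂ)) (ωfin : Representation ℂ Gfin (FinSB F (Fin n)))
    (hinf : ∀ Φ, Continuous fun g => ωinf g Φ) (hfin : ωfin.IsSmooth) (Φ : ↥(piSchwartzBruhat F (Fin n))) :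
    Continuous fun g => thetaDistLM F (Fin n) (adelicRep ωinf ωfin g Φ) :=
  (hasThetaMajorants_adelicRep_of_isSmooth ωinf ωfin hinf hfin).continuous_thetaDistLM Φ

end Smooth

end Literature.NumberTheory.Weil1964
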